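import Summits.BirchSwinnertonDyer.Rank1Residual.AdditivePotMult.ShaIsotropicCasselsTateShaLevel
import Summits.BirchSwinnertonDyer.Rank1Residual.AdditivePotMult.RankZeroShaEightyOneCertificate
import Summits.BirchSwinnertonDyer.Rank1Residual.Additive.X4ThreeResCertKernel
import Literature.NumberTheory.EllipticCurves.NonEisensteinPrimeOfSurjective
import Summits.BirchSwinnertonDyer.Rank1Residual.X10.CasselsTatePairingGram
import HarnessLib

/-!
# The `ord₃ #Ш_an = 4` road on a LITERAL minimal model: `ClassX4M W 3` decided from the integer
# a-invariants (`3 ∣ Δ`, `3 ∣ c₄`, `ord₃ c₄³ < ord₃ Δ`), and the RECORD SHAPE for the 34 (M) rows of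
# T-SHA81-M — `BSD(E,3)` from the published upper half + `#Sel^(3) = 9` + a ZERO ctp-sel3 Gram matrix
# (cell `b2b-bsdres`, sub-cell additive-p1, gen 17; per-pair consumer, the template of the records)

HONEST FRAMING (cell `b2b-bsdres`, run/shared/lean/b2b/bsd-rank1-residual/, verbatim in every
file): the goal of the cell is to DELETE the COMBINATION-SHAPED residual classes of the
Birch–Swinnerton-Dyer formula for ALL analytic-rank `≤ 1` elliptic curves over `ℚ` — "full BSD
formula for every rank `≤ 1` curve in class `C`" assembled STRICTLY from published theorems — so
that the rank-`≤ 1` remainder becomes exactly the CONSTRUCTION-SHAPED classes, which are TYPED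
(missing-input `Prop`s), NOT attempted. This is not "finishing BSD". X3♯(M)/X4(M) stay
CONSTRUCTION-SHAPED; per-pair consumer; nothing booked (the lane books, the referee signs); no record
is filed here (no ctp-sel3 document exists yet for these rows). THEOREMS ONLY (no definition, no
named fact, no `sorry`).

## What this file does

The records of the cell (x10's `X10/CasselsTatePairingRecords*.lean`, n1011's
`Additive/X4ThreeKuriharaCertRecords*.lean`) state `BSD(E,3)` for the LITERAL Cremona model
`W = [a₁,a₂,a₃,a₄,a₆]`, every class bit decided in the kernel from the integer model
`E₀ = integralModelInt W`. For the (M) road of `ShaIsotropicCasselsTateShaLevel.lean`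
(`ClassX4M.bsdp_three_rankZero_of_surj_of_ctpGramZero_of_card_selmerThree`) the class bit is
`ClassX4M W 3 = (3 ≠ 2 ∧ Addv W 3 ∧ Irr W 3) ∧ (Addv W 3 ∧ ord₃ j(W) < 0)`. §1 decides it:
* `padicValRat_j_lt_zero_of_intModel`: `¬ p^{k+1} ∣ c₄(E₀)³` and `p^{k+1} ∣ Δ(E₀)` (both
  `decide +kernel` on the literal integers) ⇒ `ord_p j(W) < 0` (`j = c₄³/Δ`, Silverman III.1;
  `Δ(W) = Δ(E₀)`, `c₄(W) = c₄(E₀)` by the tree's `IntModel.Δ_eq_cast` / `c₄_eq_cast`);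
* `potMult_of_intModel`, `classX4M_of_intModel_of_irr`, `classX4M_of_intModel_of_surj` (with
  additive-p2's `addv_of_intModel`: `p ∣ Δ(E₀) ∧ p ∣ c₄(E₀)` ⇒ additive, Silverman VII.5.1 (c); and
  `Irr ⇐ Surj`, tree `hasIrreducibleModPGaloisRep_of_hasSurjectiveModNGaloisRep`).
§2 is the RECORD SHAPE `bsdp_three_of_intModel_of_surj_of_ctpGramZero_of_card_selmerThree`: for a
globally minimal elliptic `W` with integer model `E₀`, `3 ∣ Δ`, `3 ∣ c₄`, `¬ 3^{k+1} ∣ c₄³`,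
`3^{k+1} ∣ Δ`, `ρ̄_{E,3}` onto (the records' `surj3_v<label>` theorems, Serre 1972 §2.4 Prop. 15
witnesses — 22077e1's is already in the tree, `Additive/X4ThreeKuriharaCertRecords1.lean`),
`r_an = 0`, `#Sel^(3)(E/ℚ) = 9`, a pairing on `Ш(E/ℚ)` with the printed Cassels–Tate properties
whose Gram matrix on two independent `3`-torsion classes is ZERO, and `ord₃ #Ш_an ≤ 4` ⇒ `BSD(E,3)`.
Binders beyond the pair: hDel / hGZK / hmod / hmodD / hL20 / hKato (A123) exactly as in the gen-9
upper half. Per pair; NOT a class theorem; labels unchanged.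

References: Silverman *AEC* III.1, VII.5.1, X.4.2, X.4.14 [SilvermanAEC2009]; Serre 1972 §2.4
[Serre1972]; Cassels 1998 §1 [Cassels1998]; Fisher–Newton 2014 Thm. 1.3 [FisherNewton2014];
Delbourgo 1998 Prop. 4 [Delbourgo1998]; Wuthrich 2014 Lemma 20, Cor. 19 [Wuthrich2014];
Miller 2011 Def. 1.1 [Miller2011LMS].
-/

noncomputable section

open scoped Classical

open WeierstrassCurve Literature.NumberTheory.EllipticCurves
  Literature.NumberTheory.EllipticCurves.ModularForms
  Literature.NumberTheory.EllipticCurves.Rank1Residual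
  Literature.NumberTheory.EllipticCurves.Rank1Residual.Typed
  Summit.BirchSwinnertonDyer.BirchSwinnertonDyer.Rank1Residual

namespace Summit.BirchSwinnertonDyer.Rank1Residual.AdditivePotMult

/-! ### §1 `ord_p j < 0`, `PotMult`, `ClassX4M` from the integer model -/

section IntModel

variable {W : WeierstrassCurve ℚ} [W.IsElliptic] [W.IsGloballyMinimal] {E₀ : WeierstrassCurve ℤ}
  (hI : integralModelInt W = E₀)
include hI

/-- **`ord_p j(W) < 0` from the integer model**: if `p^{k+1} ∣ Δ(E₀)` but `p^{k+1} ∤ c₄(E₀)³` then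
`ord_p(c₄³) ≤ k < k + 1 ≤ ord_p Δ`, so `ord_p j = ord_p c₄³ − ord_p Δ < 0` (`j = c₄³/Δ`).
[cite: SilvermanAEC2009, III.1 (p. 42)] -/
theorem padicValRat_j_lt_zero_of_intModel (p : ℕ) [hp : Fact p.Prime] (k : ℕ)
    (hc : ¬ (p : ℤ) ^ (k + 1) ∣ E₀.c₄ ^ 3) (hΔ : (p : ℤ) ^ (k + 1) ∣ E₀.Δ) :
    padicValRat p W.j < 0 := by
  have hΔW : W.Δ ≠ 0 := by rw [← W.coe_Δ']; exact W.Δ'.ne_zero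
  have hΔ0 : E₀.Δ ≠ 0 := by
    intro h
    apply hΔW
    rw [IntModel.Δ_eq_cast hI, h, Int.cast_zero]
  have hc0 : E₀.c₄ ^ 3 ≠ 0 := fun h => hc (h ▸ dvd_zero _)
  have hj : W.j = ((E₀.c₄ ^ 3 : ℤ) : ℚ) / ((E₀.Δ : ℤ) : ℚ) := by
    rw [WeierstrassCurve.j, Units.val_inv_eq_inv_val, coe_Δ', IntModel.Δ_eq_cast hI,
      IntModel.c₄_eq_cast hI]
    push_cast
    rw [div_eq_inv_mul]
  rw [hj, padicValRat.div (by exact_mod_cast hc0) (by exact_mod_cast hΔ0), padicValRat.of_int,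
    padicValRat.of_int]
  have h1 : ¬ (k + 1 ≤ padicValInt p (E₀.c₄ ^ 3)) := by
    intro hle
    exact hc ((padicValInt_dvd_iff (k + 1) (E₀.c₄ ^ 3)).mpr (Or.inr hle))
  have h2 : k + 1 ≤ padicValInt p E₀.Δ := by
    rcases (padicValInt_dvd_iff (k + 1) E₀.Δ).mp hΔ with h | h
    · exact absurd h hΔ0
    · exact h
  omega

/-- **`PotMult W p` from the integer model** (`p ∣ Δ`, `p ∣ c₄` ⇒ additive, Silverman VII.5.1 (c),
additive-p2's `addv_of_intModel`; `ord_p j < 0` as above). [cite: SilvermanAEC2009, VII.5 Prop. 5.1 (c)] -/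
theorem potMult_of_intModel (p : ℕ) [hp : Fact p.Prime] (hΔp : (p : ℤ) ∣ E₀.Δ)
    (hc₄p : (p : ℤ) ∣ E₀.c₄) (k : ℕ) (hc : ¬ (p : ℤ) ^ (k + 1) ∣ E₀.c₄ ^ 3)
    (hΔ : (p : ℤ) ^ (k + 1) ∣ E₀.Δ) : PotMult W p :=
  ⟨Additive.addv_of_intModel hI p hΔp hc₄p, padicValRat_j_lt_zero_of_intModel hI p k hc hΔ⟩

/-- **`ClassX4M W p` from the integer model and irreducibility of `E[p]`** (`p ≠ 2`).
[cite: SilvermanAEC2009, VII.5 Prop. 5.1 (c)] -/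
theorem classX4M_of_intModel_of_irr (p : ℕ) [hp : Fact p.Prime] (hp2 : p ≠ 2)
    (hΔp : (p : ℤ) ∣ E₀.Δ) (hc₄p : (p : ℤ) ∣ E₀.c₄) (k : ℕ) (hc : ¬ (p : ℤ) ^ (k + 1) ∣ E₀.c₄ ^ 3)
    (hΔ : (p : ℤ) ^ (k + 1) ∣ E₀.Δ) (hirr : Irr W p) : ClassX4M W p :=
  ⟨⟨hp2, Additive.addv_of_intModel hI p hΔp hc₄p, hirr⟩, potMult_of_intModel hI p hΔp hc₄p k hc hΔ⟩

/-- **`ClassX4M W p` from the integer model and `ρ̄_{E,p}` onto** (surjective ⇒ irreducible, tree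
`hasIrreducibleModPGaloisRep_of_hasSurjectiveModNGaloisRep`). [cite: Serre1972, §2.4 Prop. 15] -/
theorem classX4M_of_intModel_of_surj (p : ℕ) [hp : Fact p.Prime] (hp2 : p ≠ 2)
    (hΔp : (p : ℤ) ∣ E₀.Δ) (hc₄p : (p : ℤ) ∣ E₀.c₄) (k : ℕ) (hc : ¬ (p : ℤ) ^ (k + 1) ∣ E₀.c₄ ^ 3)
    (hΔ : (p : ℤ) ^ (k + 1) ∣ E₀.Δ) (hsurj : Surj W p) : ClassX4M W p :=
  classX4M_of_intModel_of_irr hI p hp2 hΔp hc₄p k hc hΔ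
    (hasIrreducibleModPGaloisRep_of_hasSurjectiveModNGaloisRep W p hsurj)

end IntModel

/-! ### §2 The RECORD SHAPE for the T-SHA81-M rows (literal model, `p = 3`) -/

section RecordShape

variable {W : WeierstrassCurve ℚ} [W.IsElliptic] [W.IsGloballyMinimal] {E₀ : WeierstrassCurve ℤ}

/-- **RECORD SHAPE, `p = 3`.** For a globally minimal elliptic `W/ℚ` with integer model `E₀`
(`hI`), `3 ∣ Δ(E₀)`, `3 ∣ c₄(E₀)`, `¬ 3^{k+1} ∣ c₄(E₀)³`, `3^{k+1} ∣ Δ(E₀)` (all `decide +kernel`),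
`ρ̄_{E,3}` onto (a `surj3_v<label>` theorem), `r_an(E) = 0`, `#Sel^(3)(E/ℚ) = 9`, a pairing `B` on
`Ш(E/ℚ)` with the printed Cassels–Tate properties and ZERO Gram matrix on two independent
`3`-torsion classes `x₁, x₂`, and `ord₃ #Ш(E)_an ≤ 4`: `BSD(E,3)`. Binders beyond the pair:
Delbourgo 1998 Prop. 4 (`hDel`), GZK, modularity (`hmod`, `hmodD`), Wuthrich Lemma 20 (`hL20`),
Kato 17.4 (3)–Cor. 19 `ω`-component (`hKato`, A123). Per pair; NOT a class theorem; nothing booked.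
[cite: Delbourgo1998, Prop. 4 (p. 144)] [cite: Wuthrich2014, Lemma 20 (p. 399), Cor. 19 (p. 398)]
[cite: Kato2004Asterisque, Thm. 17.4 (3) (p. 273)] [cite: FisherNewton2014, Thm. 1.3]
[cite: SilvermanAEC2009, Thm. X.4.14, Thm. X.4.2(a), VII.5 Prop. 5.1 (c)] [cite: Miller2011LMS, §1 and Def. 1.1] -/
theorem bsdp_three_of_intModel_of_surj_of_ctpGramZero_of_card_selmerThree
    (hDel : Delbourgo1998.prop4_rankZero_pow_dvd_constantCoeff)
    (hGZK : rank_eq_analyticRank_of_analyticRank_le_one) (hmod : hasEntireLFunction_rat)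
    (hmodD : nonempty_modularParametrizationData)
    (hL20 : Wuthrich2014.lemma20_surjective_threeAdic_of_semistable)
    (hKato : Wuthrich2014.kato_minusEigenCharIdeal_dvd_cyclotomicThree_of_surjective)
    (hI : integralModelInt W = E₀) (hΔ3 : (3 : ℤ) ∣ E₀.Δ) (hc₄3 : (3 : ℤ) ∣ E₀.c₄) (k : ℕ)
    (hc : ¬ (3 : ℤ) ^ (k + 1) ∣ E₀.c₄ ^ 3) (hΔ : (3 : ℤ) ^ (k + 1) ∣ E₀.Δ)
    (hsurj : W.HasSurjectiveModNGaloisRep 3) (hr : W.analyticRank = 0)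
    (hSel : Nat.card (W.selmerGroup (3 : ℤ)) = 9)
    (B : W.sha →+ W.sha →+ AddCircle (1 : ℚ)) (halt : ∀ x, B x x = 0)
    (hker : ∀ x, (∀ y, B x y = 0) ↔ x ∈ AddSubgroup.divisibleElements W.sha)
    {x₁ x₂ : W.sha} (hx₁ : 3 • x₁ = 0) (hx₂ : 3 • x₂ = 0) (hne : x₁ ≠ 0)
    (hind : x₂ ∉ AddSubgroup.zmultiples x₁)
    (h₁₁ : B x₁ x₁ = 0) (h₁₂ : B x₁ x₂ = 0) (h₂₁ : B x₂ x₁ = 0) (h₂₂ : B x₂ x₂ = 0)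
    {q : ℚ} (hq : shaAn W = (q : ℂ)) (hv : padicValRat 3 q ≤ 4) :
    haveI : Fact (Nat.Prime 3) := ⟨Nat.prime_three⟩
    BSDp W 3 := by
  haveI : Fact (Nat.Prime 3) := ⟨Nat.prime_three⟩
  have hX : ClassX4M W 3 :=
    classX4M_of_intModel_of_surj hI 3 (by norm_num) (by exact_mod_cast hΔ3) (by exact_mod_cast hc₄3) k
      (by exact_mod_cast hc) (by exact_mod_cast hΔ) hsurj
  exact ClassX4M.bsdp_three_rankZero_of_surj_of_ctpGramZero_of_card_selmerThree hDel hGZK hmod hmodD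
    hL20 hKato hX hr hsurj hSel B halt hker hx₁ hx₂ hne hind h₁₁ h₁₂ h₂₁ h₂₂ hq hv

/-- **RECORD SHAPE in the isotropic-binder form** (`hCT0`, the ∃-packaged ZERO document) with
`#Sel^(3) = 3^d` and `ord₃ #Ш_an ≤ 2d`. Per pair. [cite: Delbourgo1998, Prop. 4 (p. 144)]
[cite: Wuthrich2014, Lemma 20 (p. 399), Cor. 19 (p. 398)] [cite: SilvermanAEC2009, Thm. X.4.14 and VII.5 Prop. 5.1 (c)] -/
theorem bsdp_three_of_intModel_of_surj_of_casselsTateIsotropic_of_card_selmerThree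
    (hDel : Delbourgo1998.prop4_rankZero_pow_dvd_constantCoeff)
    (hGZK : rank_eq_analyticRank_of_analyticRank_le_one) (hmod : hasEntireLFunction_rat)
    (hmodD : nonempty_modularParametrizationData)
    (hL20 : Wuthrich2014.lemma20_surjective_threeAdic_of_semistable)
    (hKato : Wuthrich2014.kato_minusEigenCharIdeal_dvd_cyclotomicThree_of_surjective)
    (hI : integralModelInt W = E₀) (hΔ3 : (3 : ℤ) ∣ E₀.Δ) (hc₄3 : (3 : ℤ) ∣ E₀.c₄) (k : ℕ)
    (hc : ¬ (3 : ℤ) ^ (k + 1) ∣ E₀.c₄ ^ 3) (hΔ : (3 : ℤ) ^ (k + 1) ∣ E₀.Δ)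
    (hsurj : W.HasSurjectiveModNGaloisRep 3) (hr : W.analyticRank = 0)
    {d : ℕ} (hSel : Nat.card (W.selmerGroup (3 : ℤ)) = 3 ^ d)
    (hCT0 : ∃ B : W.sha →+ W.sha →+ AddCircle (1 : ℚ), (∀ x, B x x = 0) ∧
      (∀ x, (∀ y, B x y = 0) ↔ x ∈ AddSubgroup.divisibleElements W.sha) ∧
      ∀ x y : W.sha, 3 • x = 0 → 3 • y = 0 → B x y = 0)
    {q : ℚ} (hq : shaAn W = (q : ℂ)) (hv : padicValRat 3 q ≤ 2 * d) :
    haveI : Fact (Nat.Prime 3) := ⟨Nat.prime_three⟩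
    BSDp W 3 := by
  haveI : Fact (Nat.Prime 3) := ⟨Nat.prime_three⟩
  have hX : ClassX4M W 3 :=
    classX4M_of_intModel_of_surj hI 3 (by norm_num) (by exact_mod_cast hΔ3) (by exact_mod_cast hc₄3) k
      (by exact_mod_cast hc) (by exact_mod_cast hΔ) hsurj
  exact ClassX4M.bsdp_three_rankZero_of_surj_of_casselsTateIsotropic_of_card_selmerThree hDel hGZK hmod
    hmodD hL20 hKato hX hr hsurj hSel hCT0 hq hv

end RecordShape


/-! ### §3 Worked instance of §1: `22077e1` (the smallest T-SHA81-M row; a Kurihara-ZERO row of NICHE39) -/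

section Instance22077e1

variable {W : WeierstrassCurve ℚ} [W.IsElliptic] [W.IsGloballyMinimal]

/-- **`ClassX4M W 3` for Cremona's `22077e1 = [0, 0, 1, −5376115974, −151721379981842]`**
(`N = 22077 = 3²·11·223`; `v₃(c₄) = 2`, `v₃(Δ) = 48`, `ord₃ j = −42`), decided in the kernel from the
integer model (`3 ∣ Δ`, `3 ∣ c₄`, `3⁷ ∤ c₄³`, `3⁷ ∣ Δ` by `decide +kernel`), GIVEN `ρ̄_{E,3}` onto
(`hsurj`; in the tree as `surj3_v22077e1`, `Additive/X4ThreeKuriharaCertRecords1.lean`, Serre §2.4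
Prop. 15 witnesses `ℓ = 5, 7`). No BSD statement: the ctp-sel3 document for this row does not exist
yet. [cite: SilvermanAEC2009, VII.5 Prop. 5.1 (c) and III.1] -/
theorem classX4M_three_v22077e1
    (hI : integralModelInt W = ⟨0, 0, 1, -5376115974, -151721379981842⟩)
    (hsurj : W.HasSurjectiveModNGaloisRep 3) :
    haveI : Fact (Nat.Prime 3) := ⟨Nat.prime_three⟩
    ClassX4M W 3 :=
  haveI : Fact (Nat.Prime 3) := ⟨Nat.prime_three⟩
  classX4M_of_intModel_of_surj hI 3 (by norm_num) (by decide +kernel) (by decide +kernel) 6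
    (by decide +kernel) (by decide +kernel) hsurj

end Instance22077e1

/-! ### §4 (appended, gen 17) The document is DECISIVE on an `ord_p #Ш_an = 4` row: a NON-ZERO
Gram matrix would REFUTE `BSD(E,p)` (anomaly shape)

On a rank-`0` row with `p ∤ #E(ℚ)_tors`, `#Sel^(p)(E/ℚ) = p²` and `ord_p #Ш(E)_an = 4`, the ctp-sel3
document has exactly two possible verdicts: Gram ZERO ⇒ `p⁴ ∣ #Ш` ⇒ (with the published upper half)
`BSD(E,p)` (§2 / the sibling files); Gram NON-ZERO (`[0 g; g′ 0]`, `g, g′ ≠ 0`) ⇒ `Ш[p²] = Ш[p]`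
⇒ `ord_p #Ш(E) = 2` EXACTLY (x10's class-free `X10.padicValNat_shaOrder_eq_of_shaNoPSqTorsion_of_card_selmerGroup`,
NO upper-half theorem) ⇒ `¬ BSD(E,p)`. So a non-zero document on any T-SHA81-M row is a BSD
ANOMALY in the cell's sense (anomaly protocol: two engines + referee before any word) — the
certificate is falsifiable. Class-free; per pair; nothing asserted about any curve. -/

section Decisive

variable (W : WeierstrassCurve ℚ) [W.IsElliptic] (p : ℕ) [hp : Fact p.Prime]

/-- **NON-ZERO Gram on an `ord_p #Ш_an ≠ 2` row refutes `BSD(E,p)`** (rank `0`, `p ∤ #E(ℚ)_tors`,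
`#Sel^(p) = p²`): the Gram shape `[0 g; g′ 0]`, `g, g′ ≠ 0`, of ANY bi-additive pairing on `Ш(E/ℚ)`
forces `ord_p #Ш(E) = 2` (x10, class-free), while `BSD(E,p)` says `ord_p #Ш(E) = ord_p #Ш(E)_an`.
In particular on the T-SHA81-M rows (`ord₃ #Ш_an = 4`) a non-zero ctp-sel3 document = `¬ BSD(E,3)`.
[cite: Cassels1998, §1] [cite: FisherNewton2014, Thm. 1.3] [cite: SilvermanAEC2009, Thm. X.4.2(a)]
[cite: Miller2011LMS, §1 and Def. 1.1] -/
theorem not_bsdp_of_ctpGram_of_card_selmerGroup_of_padicValRat_ne_two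
    (hGZK : rank_eq_analyticRank_of_analyticRank_le_one) (hr : W.analyticRank = 0)
    (htors : ¬ p ∣ W.torsionOrder) (hSel : Nat.card (W.selmerGroup (p : ℤ)) = p ^ 2)
    {Q : Type*} [AddCommGroup Q] (B : W.sha →+ W.sha →+ Q) {x₁ x₂ : W.sha}
    (hx₁ : p • x₁ = 0) (hx₂ : p • x₂ = 0)
    (h₁₁ : B x₁ x₁ = 0) (h₂₂ : B x₂ x₂ = 0) (h₁₂ : B x₁ x₂ ≠ 0) (h₂₁ : B x₂ x₁ ≠ 0)
    {q : ℚ} (hq : shaAn W = (q : ℂ)) (hv : padicValRat p q ≠ 2) : ¬ BSDp W p := by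
  intro hB
  have hr1 : W.analyticRank ≤ 1 := by rw [hr]; norm_num
  have hrank : W.mordellWeilRank = 0 := by rw [(hGZK W hr1).1, hr]
  haveI : Finite W.sha := (hGZK W hr1).2
  have h2 : padicValNat p W.shaOrder = 2 :=
    X10.padicValNat_shaOrder_eq_of_shaNoPSqTorsion_of_card_selmerGroup W p hGZK hr htors hSel
      (X10.shaNoPSqTorsion_of_gram_of_card_selmerGroup W p hrank htors hSel B hx₁ hx₂ h₁₁ h₂₂ h₁₂ h₂₁)
  obtain ⟨q', hq', hv'⟩ := missingPPartAt_of_bsdp W p hB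
  have hqq : q' = q := by exact_mod_cast hq'.symm.trans hq
  rw [hqq, h2] at hv'
  exact hv (by exact_mod_cast hv')

/-- **The T-SHA81-M form**: `ord₃ #Ш_an = 4`, `#Sel^(3) = 9`, rank `0`, `3 ∤ #E(ℚ)_tors`: a NON-ZERO
ctp-sel3 Gram matrix refutes `BSD(E,3)`. [cite: Cassels1998, §1] [cite: FisherNewton2014, Thm. 1.3]
[cite: Miller2011LMS, §1 and Def. 1.1] -/
theorem not_bsdp_three_of_ctpGram_of_card_selmerThree_of_padicValRat_eq_four
    (hGZK : rank_eq_analyticRank_of_analyticRank_le_one) (hr : W.analyticRank = 0)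
    (htors : ¬ 3 ∣ W.torsionOrder) (hSel : Nat.card (W.selmerGroup (3 : ℤ)) = 9)
    {Q : Type*} [AddCommGroup Q] (B : W.sha →+ W.sha →+ Q) {x₁ x₂ : W.sha}
    (hx₁ : 3 • x₁ = 0) (hx₂ : 3 • x₂ = 0)
    (h₁₁ : B x₁ x₁ = 0) (h₂₂ : B x₂ x₂ = 0) (h₁₂ : B x₁ x₂ ≠ 0) (h₂₁ : B x₂ x₁ ≠ 0)
    {q : ℚ} (hq : shaAn W = (q : ℂ)) (hv : padicValRat 3 q = 4) :
    haveI : Fact (Nat.Prime 3) := ⟨Nat.prime_three⟩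
    ¬ BSDp W 3 :=
  haveI : Fact (Nat.Prime 3) := ⟨Nat.prime_three⟩
  not_bsdp_of_ctpGram_of_card_selmerGroup_of_padicValRat_ne_two W 3 hGZK hr htors
    (by rw [show (3 : ℕ) ^ 2 = 9 by norm_num]; exact_mod_cast hSel) B (by exact_mod_cast hx₁)
    (by exact_mod_cast hx₂) h₁₁ h₂₂ h₁₂ h₂₁ hq (by rw [hv]; norm_num)

end Decisive

end Summit.BirchSwinnertonDyer.Rank1Residual.AdditivePotMult

end
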